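import Summits.Ventures.HSemireg.AmplificationChainG4Etale
import Literature.AlgebraicGeometry.HodgeTheory.SemiregularReducedObstructions
import HarnessLib

/-!
# Venture HSemireg — route (C)'s ONE deformation assumption SPLIT at its printed seam, PERFECT-COMPLEX level: Pridham's
# Cor. 2.25 + Rem. 2.27 rendered for STRICTLY PERFECT complexes on target seat 7's real `σ`-carrier (venture-side `Prop`)
# + ONE Hodge-free algebraisation assumption ⟹ theory seat 3's étale assumption at `sigmaAdmissible` ⟹ the g = 4 σ-row

HONEST FRAMING. Lean index of the computation cell `pub-hsemireg` (seat p7, «assembly»). Nothing about any explicit variety is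
asserted; every published input is a hypothesis BY NAME; the object and its numbers are BY VALUE from the census; nothing here says
HC, HC_CM or HC_AV is proved; the g = 4 split case is IN PRINT ([Markman2023GeneralizedKummers] Thm. 1.5 (= Thm. 13.4; J. Eur. Math. Soc. 25 (2023) p. 236; pre-publication arXiv numbering: Thm. 1.3)) and is RE-DERIVED modulo
the named hypotheses. THREE definitions (predicates / assumptions BY NAME), theorems otherwise; no `sorry`, no new axiom, no
Literature fact declared.

## What this file does

The σ-certificate Monday row (`AmplificationChainG4Etale.lean` §4, `weilFourfoldsSplit_of_reach_of_sigmaDeformsOverEtaleNbhd_of_complex`)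
has ONE un-linked hypothesis, `hD : PerfectComplexDeformsOverEtaleNbhd C sigmaAdmissible` (theory seat 3), whose on-paper derivation
(L1)–(L6) + atlas + étale quasi-section + strictification MIXES two printed statements of different status:
(F) the HODGE-THEORETIC one — [Pridham2024Semiregularity] Cor. 2.25 + Rem. 2.27 (with Rem. 2.21 `𝓛 = σ`, Lemma 1.8–1.9): a perfect
complex on `X ⊗_A B` whose Chern character stays in `F^p` horizontally lifts across the square-zero extension `A ↠ B` as soon as
its semiregularity map is injective — REFEREED, and typed AS PRINTED in the Literature layer for finite locally free SHEAVES
(`Pridham2024_ISemiregular_liftsOverHodgeLocus_model`, seat lit-3; the perfect-complex generality could not be rendered THERE for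
want of a Literature-level `σ` of a complex); and (E)+(C) the HODGE-FREE algebraisation — [Lieblich2006] Thm. 4.2.1 + the
infinitesimal criterion [EGAIV4] Prop. 17.14.2 / [GortzWedhorn2023] Thm. 18.63 + étale quasi-section [EGAIV4] Cor. 17.16.3 (i) +
strictification [ThomasonTrobaugh1990] 2.3.1 (d), in the printed shape of [Perry2022]'s proof of Prop. 8.1.
The VENTURE tree now HAS a real `σ` for strictly perfect complexes — target seat 7's `HomComplex.IsISemiregularC` (`HomComplexSigma.lean`,
Atiyah class of a complex `ComplexAtiyahClass.lean`, supertrace `HomComplexSupertrace.lean`) — so (F) CAN be rendered at the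
perfect-complex level HERE (a `def : Prop` on the venture side, because its carrier lives on the venture side; the Literature layer
cannot import it). This file does so and splits `hD`:

* §1 `PerfectLiftsOverArtinianPointsAt π s₀ X₀ e E` (def, PREDICATE): the DERIVED small-extension lifting property of a cochain
  complex `E` on the model `X₀ ≅ 𝒳_{s₀}` — seat lit-3's `LiftsOverArtinianPointsAt` with «vector bundle `F` on `X_B`, `j^*F ≅ E₀`,
  lifts to a vector bundle `G` on `X_A` with `i^*G ≅ F`» replaced by «bounded complex of vector bundles `F` on `X_B` with
  `Q(j^*F) ≅ Q(E)` in `D(Mod 𝒪_{X₀})`, lifts to a bounded complex of vector bundles `G` on `X_A` with `Q(i^*G) ≅ Q(F)` in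
  `D(Mod 𝒪_{X_B})`» (termwise pull-backs of complexes of vector bundles ARE the derived pull-backs; isomorphism in the derived
  category, NOT of complexes — an on-the-nose lifting statement would be false, e.g. `[L → L]` with `L` obstructed).
* §1 `PridhamPerfectLifts C` (def; the PRINTED, REFEREED statement (F), typed venture-side — status words below): smooth projective
  `π : 𝒳 ⟶ S` over a smooth `S`, `U ∋ s₀` cohomologically locally trivial, a model `e`, a STRICTLY PERFECT `E` on `X₀` (bounded
  complex of vector bundles in degrees `[a, b]`) with `(σ_q(E))_{q+1 ∈ I}` JOINTLY INJECTIVE (`HomComplex.IsISemiregularC`) whose classes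
  `(e⁻¹)^* ch_p(E)` (`p ∈ I`) stay of type `(p, p)` on `U` ⟹ `PerfectLiftsOverArtinianPointsAt π s₀ X₀ e E`.
* §1 `PerfectComplexAlgebraisesLifts C` (def; ASSUMPTION BY NAME, HODGE-FREE, σ-FREE — (E)+(C)): a bounded complex of vector bundles
  `E` on the model with `Ext^{<0}(E, E) = 0` (universally gluable, `extRank`) having the derived lifting property at `s₀` deforms, as
  a bounded complex of vector bundles, over an ÉTALE neighbourhood of `s₀` with the Chern character of `E` at the marked point
  (theory seat 3's conclusion shape VERBATIM, every degree).
* §2 THEOREM `perfectComplexDeformsOverEtaleNbhd_sigma_of_pridhamPerfect_of_algebraisesLifts`: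
  `PridhamPerfectLifts C → PerfectComplexAlgebraisesLifts C → PerfectComplexDeformsOverEtaleNbhd C sigmaAdmissible` (the σ-admissible
  object supplies `IsISemiregularC` to the first and `Ext^{<0} = 0` to the second; simplicity and `{1..n} ⊆ I` are not used).
* §3 the g = 4 σ-certificate row with `hD` REPLACED by the pair — `weilFourfoldsSplit_of_reach_of_pridhamPerfect_of_algebraisesLifts_of_complex`
  (every other binder verbatim), and the schema consequences by dot-composition.

STATUS WORDS (wording rules F-1 / W-4 of the cell apply). `PridhamPerfectLifts C` is a PRINTED and REFEREED statement (FMS 12 (2024)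
e126) rendered on REAL carriers, but it is NOT a Literature fact (carrier location) and NO declaration of the tree discharges it: in
kernel terms it is a hypothesis BY NAME, exactly like `PerfectComplexDeformsOverEtaleNbhd`; what it buys is AUDITABILITY — its text can be
read against Cor. 2.25 + Rem. 2.27 line by line (the three standard glue sentences are (G-a), (G-b) of `SemiregularReducedObstructions.lean`
verbatim with «`F` flat» read for the strictly perfect `F`, and (G-c′): Lemma 1.8 gives a PERFECT lift on `X_A`, strictified on the
projective `X_A` [ThomasonTrobaugh1990, 2.3.1 (d)]). `PerfectComplexAlgebraisesLifts C` is Hodge-free standard deformation theory in the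
printed shape of [Perry2022] Prop. 8.1's proof; the kernel links it to nothing. `hD` is CONSUMED (§2: the pair ⟹ `hD`, kernel); the converse
is not claimed. The sheaf-level twins are `AmplificationChainPridham.lean` (`SheafDeformsOverEtaleNbhdOfLifts`, with the REFEREED LITERATURE
FACT in place of `PridhamPerfectLifts`) and `ArtinianPointLifting.lean` (the iteration).

## On-paper derivations (NOT kernel-linked)

`PridhamPerfectLifts`: Cor. 2.25 (FMS p. 19 L44–56) for the smooth proper SCHEME `X_A = 𝒳 ×_S Spec A → Spec A` and the perfect
complex `ℱ := F` on `X_B = X_A ⊗_A B`: by (G-a) (Hodge bundle `ℋ/F^p` locally free on the smooth = reduced `S` [Deligne1968, Thm. 5.5],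
so the flat class, of type `(p,p)` at every point of `U`, is a section of `F^p` near `s₀`, and its unique horizontal lift to
`H^{2p}_dR(X_A/A) = a^*ℋ` lies in `a^*F^p`) the ⟸-hypothesis of Cor. 2.25 holds for every `p ∈ I`, so `𝓛_{p-1}(o_e(F)) = 0` (Rem. 2.27:
the second map is injective for a smooth proper scheme over Artinian `A`), `𝓛 = σ` (Rem. 2.21), and by (G-b) (`F` is `B`-flat termwise,
`Lj^*F = j^*F ≃ E`, adjunction `Lj^* ⊣ j_*`, base change of the Atiyah class and of the trace: `σ_{X_B/B}(F) = σ_{X₀}(E) ⊗ id_I` on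
`Ext²_{X_B}(F, F ⊗_B I) ≅ Ext²_{X₀}(E, E) ⊗ I`) joint injectivity of `(σ_q(E))_{q+1 ∈ I}` gives `o_e(F) = 0`, i.e. (Lemma 1.8 with Lemma
1.9 for `Perf_X`) a perfect `G'` on `X_A` with `G' ⊗^L_A B ≃ F`; `X_A` is projective over the affine `Spec A`, so `G'` is quasi-isomorphic
to a bounded complex `G` of vector bundles [ThomasonTrobaugh1990, Prop. 2.3.1 (d)], and `Li^*G = i^*G ≃ F`. SCALARS: the tree's `σ_q`
omits BF's `(-1)^q/q!` — units over `ℂ`, same kernel (target seat 7's docstring).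
`PerfectComplexAlgebraisesLifts`: as `SheafDeformsOverEtaleNbhdOfLifts` (`AmplificationChainPridham.lean`, module docstring) with
Lieblich's stack `𝒟^b_{pug}(𝒳/S)` of universally gluable relatively perfect complexes [Lieblich2006, Thm. 4.2.1] (the hypothesis
`Ext^{<0}(E,E) = 0` makes `[E]` a point of it; gluability is open) in place of the stack of coherent sheaves: a smooth atlas `V → 𝓜` is
smooth over `S` at a point over `[E]` by the infinitesimal criterion [EGAIV4, Prop. 17.14.2; GortzWedhorn2023, Thm. 18.63] fed by the
derived lifting property (a `B`-point of `𝓜` centred at `[E]` is a `B`-perfect `F'` on `X_B` with `F'|^L_{X₀} ≃ E`, strictified to an `F`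
as in §1); étale quasi-section [EGAIV4, Cor. 17.16.3 (i)]; the universal object on `𝒳 ×_S T` is `T`-perfect hence perfect, strictified
[ThomasonTrobaugh1990, 2.3.1 (d)]; Chern characters along `X₀ ≅ (𝒳 ×_S T)_{t₀}` agree (`chPerfect_eq_of_quasiIso`, `map_chPerfect`).

References: [Pridham2024Semiregularity] Forum Math. Sigma 12 (2024) e126, Cor. 2.25, Rem. 2.27, Rem. 2.21, Lemma 1.8–1.9 ·
[Perry2022] Compositio Math. 158 (2022), proof of Prop. 8.1 · [Lieblich2006] J. Algebraic Geom. 15 (2006), Thm. 4.2.1 · [EGAIV4] Prop.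
17.14.2, Cor. 17.16.3 (i) · [GortzWedhorn2023] Thm. 18.63 · [ThomasonTrobaugh1990] Prop. 2.3.1 (d) · [Deligne1968] Thm. 5.5 ·
[BuchweitzFlenner2003] Def. 4.1, §5, Rem. 4.7 (1) · [Markman2023GeneralizedKummers] JEMS 25 (2023) Thm. 1.5 (= Thm. 13.4), p. 236 (pre-publication arXiv numbering: Thm. 1.3) · [Deligne1982HodgeCycles]
proof of Thm. 4.8 · [StacksProject] Tag 08VR (the sheaf-level carrier `LiftsAlong`, for comparison).
-/

noncomputable section

open CategoryTheory CategoryTheory.Limits AlgebraicGeometry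
open _root_.Topology _root_.Filter
open Literature.AlgebraicGeometry.Motives Literature.AlgebraicGeometry.HodgeTheory
open Literature.AlgebraicGeometry.ModuliOfAbelianVarieties Literature.AlgebraicGeometry.Deligne1982
open Literature.AlgebraicGeometry.KTheory
open Literature.AlgebraicTopology.SingularHomology

namespace Summit.Ventures.HSemireg

open Summit.HodgeConjecture.HodgeConjecture
open Summit.HodgeConjecture.HodgeConjecture.WeilTypeLadder
open Summit.HodgeConjecture.HodgeConjecture.Cruxes.HodgeAbelianVarieties.EStepSecantInduction

/-! ## §1 The derived lifting predicate, the printed statement (F) on real carriers, and the Hodge-free assumption (E)+(C) -/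

section Defs

/-- **The DERIVED small-extension lifting property of a cochain complex `E` on the model `X₀ ≅ 𝒳_{s₀}`** (PREDICATE, nothing
asserted): for every local Artinian `ℂ`-algebra `A`, every SMALL extension `f : A ↠ B` (`𝔪_A · ker f = 0`), every `ℂ`-point `ρ` of `B`,
every `A`-point `a` of `S` centred at `s₀`, every choice of the base changes `X_A = 𝒳 ×_S Spec A`, `X_B = X_A ×_A Spec B` and of the
closed fibre `j : X₀ ⟶ X_B` compatible with `e` (three `IsPullback` squares, one equation — VERBATIM seat lit-3's
`LiftsOverArtinianPointsAt`), every bounded complex of vector bundles `F` on `X_B` whose termwise (= derived) restriction `j^*F` is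
isomorphic to `E` IN THE DERIVED CATEGORY `D(Mod 𝒪_{X₀})` (Mathlib's `DerivedCategory`, constructed instance `HasDerivedCategory.standard`)
admits a bounded complex of vector bundles `G` on `X_A` with `i^*G ≅ F` in `D(Mod 𝒪_{X_B})`. This is "`[F]` lies in the image of
`e_* : π₀(Perf_{X_A}) → π₀(Perf_{X_B})`" ([Pridham2024Semiregularity] Lemma 1.8) for strictly perfect representatives (every perfect
complex on the projective `X_A`, `X_B` has one). [cite: Pridham2024Semiregularity, Lemma 1.8–1.9 (the shape of the conclusion)]
[cite: ThomasonTrobaugh1990, Prop. 2.3.1 (d)] -/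
def PerfectLiftsOverArtinianPointsAt {𝒳 S : SchemeOver ℂ} (π : 𝒳 ⟶ S) (s₀ : ComplexPoints S) (X₀ : SchemeOver ℂ)
    (e : X₀ ≅ fiberOver π s₀) (E : CochainComplex X₀.left.Modules ℤ) : Prop :=
  ∀ (A B : Type) [CommRing A] [Algebra ℂ A] [IsArtinianRing A] [IsLocalRing A]
    [CommRing B] [Algebra ℂ B] (f : A →ₐ[ℂ] B), Function.Surjective f →
    IsLocalRing.maximalIdeal A * RingHom.ker f = ⊥ →
    ∀ (ρ : B →ₐ[ℂ] ℂ) (a : specOver ℂ A ⟶ S),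
      Spec.map (CommRingCat.ofHom (ρ.comp f).toRingHom) ≫ a.left = s₀.left →
      ∀ ⦃XA XB : Scheme⦄ (gA : XA ⟶ 𝒳.left) (qA : XA ⟶ Spec (.of A)),
        IsPullback gA qA π.left a.left →
        ∀ (i : XB ⟶ XA) (qB : XB ⟶ Spec (.of B)),
          IsPullback i qB qA (Spec.map (CommRingCat.ofHom f.toRingHom)) →
          ∀ (j : X₀.left ⟶ XB),
            IsPullback j X₀.hom qB (Spec.map (CommRingCat.ofHom ρ.toRingHom)) →
            j ≫ i ≫ gA = e.hom.left ≫ (fiberι π s₀).left →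
            ∀ (F : CochainComplex XB.Modules ℤ), IsBoundedVBComplex F →
              (letI := HasDerivedCategory.standard X₀.left.Modules
               Nonempty (DerivedCategory.Q.obj
                  (((Scheme.Modules.pullback j).mapHomologicalComplex (ComplexShape.up ℤ)).obj F) ≅
                 DerivedCategory.Q.obj E)) →
              ∃ (G : CochainComplex XA.Modules ℤ) (_ : IsBoundedVBComplex G),
                letI := HasDerivedCategory.standard XB.Modules
                Nonempty (DerivedCategory.Q.obj
                    (((Scheme.Modules.pullback i).mapHomologicalComplex (ComplexShape.up ℤ)).obj G) ≅
                  DerivedCategory.Q.obj F)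

/-- **Pridham 2024, Cor. 2.25 with Rem. 2.27, Rem. 2.21 (`𝓛 = σ`) and Lemma 1.8–1.9 — STRICTLY PERFECT complexes, special fibre
up to a model isomorphism, infinitesimal form, on the venture's REAL `σ`-carrier** (target seat 7's `HomComplex.IsISemiregularC`).
Printed (FMS p. 19 L44–56 = Cor. 2.25; p. 2 L39–53): "Take a local Artinian `ℂ`-algebra `A`, a smooth morphism `X → Spec A` […] and
square-zero ideal `I ⊂ A` with quotient `B = A/I`. Then for any perfect complex `ℱ` over `X' := X ⊗_A B`, with obstruction
`o(ℱ) ∈ Ext²_{𝒪_{X'}}(ℱ, ℱ ⊗_B I)` to deforming `ℱ` to a complex of `𝒪_X`-modules, the image of the Chern character `ch_p(ℱ)` […] lies in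
`F^p H^{2p}(X, Ω^•_{X/A})` if and only if `o(ℱ)` maps to zero under the composite map `Ext² —σ_{p-1}→ H^{p+1}(X, I Ω^{p-1}_{X/A}) →
H^{2p}(X, Ω^{<p}_{X/A})`"; Rem. 2.27 (p. 20 L28–57): for "`X` a smooth proper scheme over `Spec R`", `R` a Noetherian `ℚ`-algebra, the last
map is injective and "restricting to the Hodge locus of [Voi] […] we then have a functorial obstruction theory `[ℱ] ↦ ker(𝓛_{p-1} …)`";
Rem. 2.21: "`𝓛` is the same as the semiregularity map `σ` of [BF1]"; Lemma 1.8: "`o_e(x)` […] is zero if and only if `[x]` lies in the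
image of `e_* : π_0(FA) → π_0(FB)`". RENDERING (binders = those of the Literature fact `Pridham2024_ISemiregular_liftsOverHodgeLocus_model`
with the sheaf `E₀` replaced by a bounded complex `E` of vector bundles on `X₀` in degrees `[a, b]`, `IsISemiregular` by
`HomComplex.IsISemiregularC X₀ E a b hE {q | q + 1 ∈ I}`, `C.ch X₀ E₀ p` by `chPerfect C X₀ E hE p`, and the conclusion by the DERIVED
lifting predicate `PerfectLiftsOverArtinianPointsAt`): for `π : 𝒳 ⟶ S` smooth projective of relative dimension `n` over a SMOOTH `S`,
`U ∋ s₀` cohomologically locally trivial, `e : X₀ ≅ 𝒳_{s₀}`, such an `E` with `(σ_q(E))_{q+1 ∈ I}` jointly injective and the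
transports of `(e⁻¹)^* ch_p(E)` of type `(p, p)` on `U` for `p ∈ I` ⟹ `E` has the derived small-extension lifting property at `s₀`.
Glue sentences between print and rendering: (G-a), (G-b) of `SemiregularReducedObstructions.lean` (module docstring) read for the
termwise-flat `F`, and (G-c′) strictification of the perfect lift on the projective `X_A` [ThomasonTrobaugh1990, 2.3.1 (d)]. STATUS: a
PRINTED, REFEREED statement typed on real carriers on the VENTURE side (its `σ`-carrier is a venture declaration; the Literature
layer renders the finite-locally-free case only); NOT a Literature fact; no declaration of the tree discharges it — a hypothesis BY
NAME (wording rule F-1). [cite: Pridham2024Semiregularity, Cor. 2.25; Rem. 2.27; Rem. 2.21; Lemma 1.8–1.9; Intro Theorem p. 2 L39–53]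
[cite: BuchweitzFlenner2003, Def. 4.1, §5 (I-semiregular) and Rem. 4.7 (1)] [cite: Deligne1968, Thm. 5.5]
[cite: ThomasonTrobaugh1990, Prop. 2.3.1 (d)] -/
def PridhamPerfectLifts (C : ChernCharacterBetti) : Prop :=
  ∀ ⦃𝒳 S : SchemeOver ℂ⦄ (π : 𝒳 ⟶ S) (n : ℕ),
    IsSmoothProjectiveFamily π n → _root_.AlgebraicGeometry.Smooth S.hom →
    ∀ ⦃U : Set (ComplexPoints S)⦄ (hU : IsCohomologicallyLocallyTrivialOn π U) (s₀ : U)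
      (X₀ : SchemeOver ℂ) (e : X₀ ≅ fiberOver π s₀.1)
      (E : CochainComplex X₀.left.Modules ℤ) (a b : ℤ) (_ : E.IsStrictlyGE a) (_ : E.IsStrictlyLE b)
      (hE : ∀ i, IsFiniteLocallyFree (E.X i)) (I : Finset ℕ),
      (letI := HasDerivedCategory.standard X₀.left.Modules
       HomComplex.IsISemiregularC X₀ E a b hE {q | q + 1 ∈ I}) →
      (∀ p ∈ I, ∀ (t : U) (γ : Path.Homotopic.Quotient s₀ t),
          IsOfHodgeType n (fiberOver π t.1) (2 * p) p p
            (transportFun π (2 * p) hU γ (complexBetti.map e.inv (2 * p) (chPerfect C X₀ E hE p)))) →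
      PerfectLiftsOverArtinianPointsAt π s₀.1 X₀ e E

/-- **Algebraisation of an infinitesimally unobstructed universally gluable perfect complex over an ÉTALE NEIGHBOURHOOD of the base
point** (ASSUMPTION BY NAME of the venture; HODGE-FREE, σ-FREE — the (E)+(C) half). Binders: `C`; `π : 𝒳 ⟶ S` smooth projective of
relative dimension `n` over a SMOOTH `S`; `s₀ ∈ S(ℂ)`; a model `e : X₀ ≅ 𝒳_{s₀}`; a bounded complex of vector bundles `E` on `X₀` with
`Ext^{k}_{D(X₀)}(E, E) = 0` for `k < 0` (`extRank`, seat p4 — Lieblich's «universally gluable») having the DERIVED small-extension lifting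
property at `s₀` (`PerfectLiftsOverArtinianPointsAt`). CONCLUSION — VERBATIM theory seat 3's étale shape, every degree: an ÉTALE
`ρ : T ⟶ S`, `t₀ ∈ T(ℂ)` over `s₀`, a bounded complex of vector bundles `ℰ` on `𝒳 ×_S T` with `ch_p(ℰ|_{t₀})`, carried to `𝒳_{s₀}`, equal
to `(e⁻¹)^* ch_p(E)` for every `p`. PRINTED SHAPE: [Perry2022] proof of Prop. 8.1 («surjective» dropped, classes only — WEAKER than print).
ON PAPER (module docstring): Lieblich's algebraic l.f.p. stack of universally gluable relatively perfect complexes [Lieblich2006, Thm.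
4.2.1]; a smooth atlas is smooth over `S` at a point over `[E]` by the infinitesimal criterion [EGAIV4, Prop. 17.14.2; GortzWedhorn2023,
Thm. 18.63] fed by the HYPOTHESIS; étale quasi-section [EGAIV4, Cor. 17.16.3 (i)]; strictification [ThomasonTrobaugh1990, 2.3.1 (d)];
`chPerfect_eq_of_quasiIso`. THE KERNEL LINKS IT TO NOTHING (F-1). Sheaf-level twin: `SheafDeformsOverEtaleNbhdOfLifts`
(`AmplificationChainPridham.lean`). [cite: Perry2022, proof of Prop. 8.1] [cite: Lieblich2006, Thm. 4.2.1]
[cite: EGAIV4, Prop. 17.14.2 and Cor. 17.16.3 (i)] [cite: GortzWedhorn2023, Thm. 18.63] [cite: ThomasonTrobaugh1990, Prop. 2.3.1 (d)] -/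
def PerfectComplexAlgebraisesLifts (C : ChernCharacterBetti) : Prop :=
  ∀ ⦃𝒳 S : SchemeOver ℂ⦄ (π : 𝒳 ⟶ S) (n : ℕ),
    IsSmoothProjectiveFamily π n → _root_.AlgebraicGeometry.Smooth S.hom →
    ∀ (s₀ : ComplexPoints S) (X₀ : SchemeOver ℂ) (e : X₀ ≅ fiberOver π s₀)
      (E : CochainComplex X₀.left.Modules ℤ) (hE : IsBoundedVBComplex E),
      (∀ k : ℤ, k < 0 → extRank X₀ E k = 0) →
      PerfectLiftsOverArtinianPointsAt π s₀ X₀ e E →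
      ∃ (T : SchemeOver ℂ) (ρ : T ⟶ S) (_ : Etale ρ.left) (t₀ : ComplexPoints T)
        (_ : AlgPoints.map ρ t₀ = s₀)
        (ℰ : CochainComplex (familyPullback π ρ).left.Modules ℤ) (hℰ : IsBoundedVBComplex ℰ),
        ∀ p : ℕ,
          FiberClass.baseChange π ρ (2 * p)
              (globalSection (familyPullback.snd π ρ) (2 * p)
                (chPerfect C (familyPullback π ρ) ℰ hℰ.isFiniteLocallyFree p) t₀) =
            ⟨s₀, complexBetti.map e.inv (2 * p) (chPerfect C X₀ E hE.isFiniteLocallyFree p)⟩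

end Defs

/-! ## §2 The split, kernel-composed: (F) ∧ (E)+(C) ⟹ theory seat 3's étale assumption at the σ-class -/

section Split

variable {C : ChernCharacterBetti}

/-- **`PridhamPerfectLifts C ∧ PerfectComplexAlgebraisesLifts C ⟹ PerfectComplexDeformsOverEtaleNbhd C sigmaAdmissible`** (PROVED):
for a σ-admissible object (`sigmaAdmissible`: `{1..n} ⊆ I`, `Ext^{<0}(E,E) = 0`, `Hom(E,E) = ℂ`, `E` strictly perfect in `[a,b]` with
`(σ_q)_{q+1 ∈ I}` jointly injective) whose classes stay Hodge on `U`, (F) gives the derived small-extension lifting property at `s₀`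
(it uses the semiregularity clause and the Hodge hypothesis), (E)+(C) turns it into the étale deformation (it uses `Ext^{<0} = 0`);
simplicity and `{1..n} ⊆ I` are not used. Hence EVERY consumer of theory seat 3's `hD` at `sigmaAdmissible` — the g = 4 σ-row, the
`𝒜_4` per-component form, target seat 7's `PerfectComplexSigmaTransfer C` — runs on the pair (§3). Wording rule W-4: `hD` is CONSUMED here
(pair ⟹ `hD`, kernel); the converse is not claimed. [cite: Pridham2024Semiregularity, Cor. 2.25; Rem. 2.27; Lemma 1.8–1.9]
[cite: Perry2022, proof of Prop. 8.1] [cite: Lieblich2006, Thm. 4.2.1] -/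
theorem perfectComplexDeformsOverEtaleNbhd_sigma_of_pridhamPerfect_of_algebraisesLifts (hP : PridhamPerfectLifts C)
    (hA : PerfectComplexAlgebraisesLifts C) : PerfectComplexDeformsOverEtaleNbhd C sigmaAdmissible := by
  intro 𝒳 S π n hπ hS U hU s₀ X₀ e κ I hobj hHodge
  obtain ⟨E, hEb, ⟨-, hneg, -, a, b, hGE, hLE, hE, hσ⟩, hκ⟩ := hobj
  have hHodge' : ∀ p ∈ I, ∀ (t : U) (γ : Path.Homotopic.Quotient s₀ t),
      IsOfHodgeType n (fiberOver π t.1) (2 * p) p p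
        (transportFun π (2 * p) hU γ (complexBetti.map e.inv (2 * p) (chPerfect C X₀ E hE p))) := fun p hp t γ => by
    have h := hHodge p hp t γ
    rw [hκ p hp] at h
    exact h
  -- (F): the printed statement gives the derived lifting property; (E)+(C): the Hodge-free assumption algebraises it
  obtain ⟨T, ρ, hρ, t₀, ht₀, ℰ, hℰ, hch⟩ :=
    hA π n hπ hS s₀.1 X₀ e E hEb hneg (hP π n hπ hS hU s₀ X₀ e E a b hGE hLE hE I hσ hHodge')
  refine ⟨T, ρ, hρ, t₀, ht₀, ℰ, hℰ, fun p hp => ?_⟩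
  rw [hκ p hp]
  exact hch p

/-- The pair feeds p4's door at the σ-class, i.e. target seat 7's `PerfectComplexSigmaTransfer C` (theory seat 3's spread).
[cite: BuchweitzFlenner2003, §5, proof of Thm. 5.1] -/
theorem perfectComplexSigmaTransfer_of_pridhamPerfect_of_algebraisesLifts (hP : PridhamPerfectLifts C)
    (hA : PerfectComplexAlgebraisesLifts C) : PerfectComplexSigmaTransfer C :=
  (perfectComplexSigmaTransfer_iff C).2
    (perfectComplexDeformsOverEtaleNbhd_sigma_of_pridhamPerfect_of_algebraisesLifts hP hA).perfectComplexVariationalHodge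

end Split

/-! ## §3 g = 4: the σ-certificate census row on the SPLIT trust base (every other binder verbatim) -/

section FourSplit

variable {C : ChernCharacterBetti}

/-- **g = 4, route (C), σ-TIER — THE SPLIT MONDAY FORM.** BY NAME: `weilFamilyReach_hyperbolic` (Deligne, refereed tree fact) and, in
place of theory seat 3's ONE assumption `PerfectComplexDeformsOverEtaleNbhd C sigmaAdmissible` (here CONSUMED, §2), the PAIR
`PridhamPerfectLifts C` (the PRINTED, REFEREED Hodge-theoretic statement [Pridham2024Semiregularity] Cor. 2.25 + Rem. 2.27 + Rem. 2.21 +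
Lemma 1.8–1.9 for strictly perfect complexes, typed on target seat 7's real `σ`-carrier; venture-side `Prop`, not a Literature fact,
hypothesis by name) and `PerfectComplexAlgebraisesLifts C` (HODGE-FREE algebraisation, printed shape [Perry2022] proof of Prop. 8.1;
kernel-linked to nothing). BY VALUE (verbatim the σ-row of `AmplificationChainG4Etale.lean` §4): the split CM anchor `(P, ψ₀, e, a)` and
hyperbolicity; `w ≠ 0` rational in the Weil plane; `I ⊇ {1,2,3,4}`; ONE bounded complex of vector bundles `E` on `P.X` in `[a', b']` with
`Ext^{<0}(E,E) = 0`, `Hom(E,E) = ℂ` (`extRank`) and `(σ_q(E))_{q+1 ∈ I}` JOINTLY INJECTIVE (`hσ` — the census certificate «σ-rank = dim Ext² =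
18, two codes»); `ch₂(E) = q·h_K² + w`, `ch_p(E) = c_p·h_Kᵖ` off `2`. Conclusion: `Stubs.WeilAlgebraicSplitHyperplane 2 d` — the Weil classes
of EVERY abelian fourfold of the split `ℚ(√-d)`-Weil component are algebraic (in print: [Markman2023GeneralizedKummers] Thm. 1.5 (= Thm. 13.4; J. Eur. Math. Soc. 25 (2023) p. 236; pre-publication arXiv numbering: Thm. 1.3);
re-derived, no new case). For the STEP-0 object by value: `P = X × X̂`, `E = Φ(I_{p×X ∪ X×q}) ⊗ M_B`, `Ext^• = (1,8,18,8,1)`, full `σ`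
injective, `d ∈ {3,7,11,15}`. [cite: Markman2023GeneralizedKummers, Theorem 1.5 (= Theorem 13.4), p. 236 (the case in print; arXiv:1805.11574 pre-publication numbering: Theorem 1.3)]
[cite: Pridham2024Semiregularity, Cor. 2.25; Rem. 2.27; Rem. 2.21; Lemma 1.8–1.9] [cite: Perry2022, proof of Prop. 8.1]
[cite: Lieblich2006, Thm. 4.2.1] [cite: BuchweitzFlenner2003, Def. 4.1 and §5 (I-semiregular)] [cite: Deligne1982HodgeCycles, proof of Thm. 4.8] -/
theorem weilFourfoldsSplit_of_reach_of_pridhamPerfect_of_algebraisesLifts_of_complex (hF : weilFamilyReach_hyperbolic)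
    (hP : PridhamPerfectLifts C) (hA : PerfectComplexAlgebraisesLifts C) {d : ℕ} (hd : 0 < d)
    (P : AbelianVariety ℂ) (ψ₀ : P ⟶ P) (e : ProjectiveEmbedding P.X) (a : complexBetti (projectiveSpace e.n ℂ) 2)
    (hP4 : P.dim = 2 * 2) (hψ : ψ₀ ≫ ψ₀ = -(d • 𝟙 P)) (ha : IsRationalClass a) (ha0 : a ≠ 0)
    (hhyp : IsHyperbolicWeilType P ψ₀ 2 (symmetrisedClass d P ψ₀ e a))
    (w : complexBetti P.X (2 * 2)) (hwW : w ∈ weilClassesOf P ψ₀ 2 d) (hwr : IsRationalClass w) (hw0 : w ≠ 0)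
    (I : Finset ℕ) (hI : ∀ p : ℕ, 1 ≤ p → p ≤ 2 * 2 → p ∈ I) (E : CochainComplex P.X.left.Modules ℤ)
    (hE : IsBoundedVBComplex E) (hneg : ∀ k : ℤ, k < 0 → extRank P.X E k = 0) (h0 : extRank P.X E 0 = 1)
    (a' b' : ℤ) [E.IsStrictlyGE a'] [E.IsStrictlyLE b']
    (hσ : letI := HasDerivedCategory.standard P.X.left.Modules
      HomComplex.IsISemiregularC P.X E a' b' hE.isFiniteLocallyFree {q | q + 1 ∈ I})
    (q : ℚ) (c : ℕ → ℚ)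
    (hch2 : chPerfect C P.X E hE.isFiniteLocallyFree 2 = ((q : ℚ) : ℂ) • cupPowTwo (symmetrisedClass d P ψ₀ e a) 2 + w)
    (hchp : ∀ p ∈ I, p ≠ 2 →
      chPerfect C P.X E hE.isFiniteLocallyFree p = ((c p : ℚ) : ℂ) • cupPowTwo (symmetrisedClass d P ψ₀ e a) p) :
    Stubs.WeilAlgebraicSplitHyperplane 2 d :=
  weilFourfoldsSplit_of_reach_of_sigmaDeformsOverEtaleNbhd_of_complex hF
    (perfectComplexDeformsOverEtaleNbhd_sigma_of_pridhamPerfect_of_algebraisesLifts hP hA) hd P ψ₀ e a hP4 hψ ha ha0 hhyp w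
    hwW hwr hw0 I hI E hE hneg h0 a' b' hσ q c hch2 hchp

/-- **Schema level on the split trust base** (any hyperbolic seed of the σ-class): reach ∧ (F) ∧ (E)+(C) ∧
`HasHyperbolicSeedOn (sigmaObjClass C) 2 d` ⟹ `Stubs.WeilAlgebraicSplitHyperplane 2 d`.
[cite: Markman2023GeneralizedKummers, Theorem 1.5 (= Theorem 13.4), p. 236 (the case in print; arXiv:1805.11574 pre-publication numbering: Theorem 1.3)] [cite: Pridham2024Semiregularity, Cor. 2.25; Rem. 2.27]
[cite: Deligne1982HodgeCycles, proof of Thm. 4.8] -/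
theorem weilFourfoldsSplit_of_reach_of_pridhamPerfect_of_algebraisesLifts_of_hyperbolicSeedOn (hF : weilFamilyReach_hyperbolic)
    (hP : PridhamPerfectLifts C) (hA : PerfectComplexAlgebraisesLifts C) {d : ℕ} (hd : 0 < d)
    (hS : HasHyperbolicSeedOn (sigmaObjClass C) 2 d) : Stubs.WeilAlgebraicSplitHyperplane 2 d :=
  weilFourfoldsSplit_of_reach_of_deformsOverEtaleNbhd_of_hyperbolicSeedOn hF
    (perfectComplexDeformsOverEtaleNbhd_sigma_of_pridhamPerfect_of_algebraisesLifts hP hA) hd hS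

end FourSplit

/-! ## Audit: what is assumed, what is proved
ASSUMED BY NAME in §3: `weilFamilyReach_hyperbolic` (refereed), `PridhamPerfectLifts C` (printed + refereed statement, venture-typed over
a real carrier, undischarged), `PerfectComplexAlgebraisesLifts C` (Hodge-free, kernel-linked to nothing) — and the census object BY VALUE.
PROVED: §2 (the pair ⟹ theory seat 3's `hD` at `sigmaAdmissible` ⟹ p4's door / target seat 7's transfer). NOT here: the sheaf ↔ complex
comparison of the two lifting predicates (`E₀[0]`: needs «a perfect deformation of a vector bundle is a vector bundle», not in the tree),
HC_CM, CM density, Mumford–Tate finiteness. -/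

end Summit.Ventures.HSemireg

end
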